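import Summits.CriticalPhenomena.SAWScalingLimit.Theorems.SAWTotalPositivityBoundaryTP2Defs
import Summits.CriticalPhenomena.SAWScalingLimit.Theorems.SAWTotalPositivityBoundaryTP2Kernel
import Summits.CriticalPhenomena.SAWScalingLimit.Theorems.SAWTotalPositivityBoundaryTP2Symmetry
import Summits.CriticalPhenomena.SAWScalingLimit.Theorems.SAWTotalPositivityBoundaryTP2RectReflect
import Summits.CriticalPhenomena.SAWScalingLimit.Theorems.SAWTotalPositivityBoundaryTP2LadderMinorCB
import Summits.CriticalPhenomena.SAWScalingLimit.Theorems.SAWTotalPositivityBoundaryTP2LadderBbbtAdjacent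
import Summits.CriticalPhenomena.SAWScalingLimit.Theorems.SAWTotalPositivityBoundaryTP2LadderBbbtRungAdjacent
import Summits.CriticalPhenomena.SAWScalingLimit.Theorems.SAWTotalPositivityBoundaryTP2LadderBbbtInnerAdjacent
import Summits.CriticalPhenomena.SAWScalingLimit.Theorems.SAWTotalPositivityBoundaryTP2LadderBbbtOverNested
import Summits.CriticalPhenomena.SAWScalingLimit.Theorems.EdgeOfPositivity.Negative.EdgeOfPositivityRectDomain
import HarnessLib

/-!
# Crux `BoundaryTP2` (stmt-CriticalPhenomena-7115), line `Sketch`: the dispatcher `ladder_ccw_bbbt`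

Wave-7 dispatcher of the line's skeleton: on the ladder `{0..L} × {0,1}` (the discrete domain at mesh `1` of
`rectDomain L 1`), for three bottom sites `(c₁,0), (c₂,0), (c₃,0)` with `c₁ < c₂ < c₃ ≤ L` and ANY top site
`(c₄,1)`, `c₄ ≤ L` — the counter-clockwise quadruple `q₁ = (c₁,0), q₂ = (c₂,0), q₃ = (c₃,0), q₄ = (c₄,1)` —
both non-crossing pairings beat the crossing one for the self-avoiding path kernel `Z` at every `0 ≤ x ≤ 1/2`:

* `N1`: `Z(q₁,q₃) Z(q₂,q₄) ≤ Z(q₁,q₂) Z(q₃,q₄)` (adjacent pairing),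
* `N2`: `Z(q₁,q₃) Z(q₂,q₄) ≤ Z(q₁,q₄) Z(q₂,q₃)` (nested pairing).

No new analysis: `N1` is a five-way case split on the top column `c₄` against `c₂, c₃`, each branch a landed
ladder inequality verbatim (`stub_ladder_bbbt_adjacent` for `c₃ < c₄`, `stub_ladder_bbbt_rung_adjacent` for
`c₄ = c₃`, `stub_ladder_bbbt_inner_adjacent` for `c₂ < c₄ < c₃`), the mirror image under `c ↦ L - c` of
`stub_ladder_bbbt_over_nested` for `c₄ = c₂`, or, for `c₄ < c₂`, the column-separated minor `stub_ladder_minorCB`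
with the two left sites `(c₄,1), (c₁,0)` and the two right sites `(c₂,0), (c₃,0)` (plus the symmetry
`Z(a,b) = Z(b,a)`).  `N2` is then the MIRROR IMAGE of `N1`
under the column reflection `c ↦ L - c` (`stub_rect_reflect`): `N1` for the bottom sites `L-c₃ < L-c₂ < L-c₁` and
the top site `(L-c₄,1)` reads, after reflecting back, `Z(q₃,q₁) Z(q₂,q₄) ≤ Z(q₃,q₂) Z(q₁,q₄)`, which is `N2`.
-/

noncomputable section

namespace Summit.CriticalPhenomena.SAWScalingLimit.Theorems.BoundaryTP2

open Literature.Probability.LatticeModels Literature.Probability.RandomPlanarGeometry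
open Summit.CriticalPhenomena.SAWScalingLimit.Theorems.EdgeOfPositivity.Negative
open scoped ENNReal

/-- Column reflection `c ↦ L - c` of the ladder kernel with natural-number columns `c, c' ≤ L`:
`Z((L-c, r), (L-c', r')) = Z((c, r), (c', r'))` (first conjunct of `stub_rect_reflect`, casts
rearranged with `Nat.cast_sub`). [folklore] -/
private theorem ccwBbbt_reflect (L : ℕ) (x : ℝ) {c c' : ℕ} (hc : c ≤ L) (hc' : c' ≤ L) (r r' : ℤ) :
    pathKernel (discreteDomainGraph (rectDomain L 1) 1) x (st ((L - c : ℕ) : ℤ) r)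
        (st ((L - c' : ℕ) : ℤ) r') =
      pathKernel (discreteDomainGraph (rectDomain L 1) 1) x (st c r) (st c' r') := by
  rw [Nat.cast_sub hc, Nat.cast_sub hc']
  exact ((stub_rect_reflect L 1 x c r c' r').1).symm

/-- The case `c₄ < c₂` of the adjacent pairing: the two left sites `(c₄,1), (c₁,0)` are strictly left of
the two right sites `(c₂,0), (c₃,0)` (columns), so the column-separated minor `stub_ladder_minorCB`
applies (`(c₄,1)` precedes `(c₁,0)` in the left-end order whatever the columns; `(c₂,0)` precedes
`(c₃,0)` in the right-end order as `c₂ < c₃`); its conclusion is `N1` up to `Z(a,b) = Z(b,a)`. [folklore] -/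
private theorem ccwBbbt_N1_left (L : ℕ) {c₁ c₂ c₃ c₄ : ℕ} (h₁₂ : c₁ < c₂) (h₂₃ : c₂ < c₃) (h₃ : c₃ ≤ L)
    (h₄₂ : c₄ < c₂) {x : ℝ} (hx0 : 0 ≤ x) (hx : x ≤ 1 / 2) :
    pathKernel (discreteDomainGraph (rectDomain L 1) 1) x (st c₁ 0) (st c₃ 0) *
        pathKernel (discreteDomainGraph (rectDomain L 1) 1) x (st c₂ 0) (st c₄ 1) ≤
      pathKernel (discreteDomainGraph (rectDomain L 1) 1) x (st c₁ 0) (st c₂ 0) *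
        pathKernel (discreteDomainGraph (rectDomain L 1) 1) x (st c₃ 0) (st c₄ 1) := by
  have key := stub_ladder_minorCB L (i₁ := c₄) (i₂ := c₁) (j₁ := c₂) (j₂ := c₃)
    (r₁ := 1) (r₂ := 0) (s₁ := 0) (s₂ := 0) (Or.inr rfl) (Or.inl rfl) (Or.inl rfl) (Or.inl rfl)
    (lt_min (max_lt h₄₂ h₁₂) (max_lt (h₄₂.trans h₂₃) (h₁₂.trans h₂₃))) (h₂₃.le.trans h₃) h₃
    (Or.inl ⟨rfl, rfl⟩) (Or.inr (Or.inl ⟨rfl, rfl, h₂₃⟩)) hx0 hx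
  rw [pathKernel_comm _ x (st (c₂ : ℤ) 0) (st (c₄ : ℤ) 1),
    pathKernel_comm _ x (st (c₃ : ℤ) 0) (st (c₄ : ℤ) 1)]
  exact (mul_comm _ _).trans_le (key.trans_eq (mul_comm _ _))

/-- The case `c₄ = c₂` of the adjacent pairing (top site above the middle bottom site): the mirror image under
the column reflection `c ↦ L - c` (`stub_rect_reflect`) of the landed tight inequality
`stub_ladder_bbbt_over_nested` for the bottom sites `L-c₃ < L-c₂ < L-c₁`, which reads, reflected back,
`Z(q₃,q₁) Z(q₂,(c₂,1)) ≤ Z(q₃,(c₂,1)) Z(q₂,q₁)`. [folklore] -/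
private theorem ccwBbbt_N1_over (L : ℕ) {c₁ c₂ c₃ : ℕ} (h₁₂ : c₁ < c₂) (h₂₃ : c₂ < c₃) (h₃ : c₃ ≤ L)
    {x : ℝ} (hx0 : 0 ≤ x) (hx : x ≤ 1 / 2) :
    pathKernel (discreteDomainGraph (rectDomain L 1) 1) x (st c₁ 0) (st c₃ 0) *
        pathKernel (discreteDomainGraph (rectDomain L 1) 1) x (st c₂ 0) (st c₂ 1) ≤
      pathKernel (discreteDomainGraph (rectDomain L 1) 1) x (st c₁ 0) (st c₂ 0) *
        pathKernel (discreteDomainGraph (rectDomain L 1) 1) x (st c₃ 0) (st c₂ 1) := by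
  have h₂ : c₂ ≤ L := h₂₃.le.trans h₃
  have h₁ : c₁ ≤ L := h₁₂.le.trans h₂
  have key := stub_ladder_bbbt_over_nested L (c₁ := L - c₃) (c₂ := L - c₂) (c₃ := L - c₁)
    (by omega) (by omega) (Nat.sub_le L c₁) hx0 hx
  rw [ccwBbbt_reflect L x h₃ h₁ 0 0, ccwBbbt_reflect L x h₂ h₂ 0 1, ccwBbbt_reflect L x h₃ h₂ 0 1,
    ccwBbbt_reflect L x h₂ h₁ 0 0, pathKernel_comm _ x (st (c₃ : ℤ) 0) (st (c₁ : ℤ) 0),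
    pathKernel_comm _ x (st (c₂ : ℤ) 0) (st (c₁ : ℤ) 0)] at key
  exact key.trans_eq (mul_comm _ _)

/-- The adjacent pairing `N1` for every top column `c₄ ≤ L`: five-way case split on `c₄` against `c₂, c₃`,
each branch a landed ladder inequality (`stub_ladder_bbbt_adjacent`, `_rung_adjacent`, `_inner_adjacent`),
the mirrored `_over_nested` (`ccwBbbt_N1_over`) or the column-separated minor (`ccwBbbt_N1_left`). [folklore] -/
private theorem ccwBbbt_N1 (L : ℕ) {c₁ c₂ c₃ c₄ : ℕ} (h₁₂ : c₁ < c₂) (h₂₃ : c₂ < c₃) (h₃ : c₃ ≤ L)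
    (h₄ : c₄ ≤ L) {x : ℝ} (hx0 : 0 ≤ x) (hx : x ≤ 1 / 2) :
    pathKernel (discreteDomainGraph (rectDomain L 1) 1) x (st c₁ 0) (st c₃ 0) *
        pathKernel (discreteDomainGraph (rectDomain L 1) 1) x (st c₂ 0) (st c₄ 1) ≤
      pathKernel (discreteDomainGraph (rectDomain L 1) 1) x (st c₁ 0) (st c₂ 0) *
        pathKernel (discreteDomainGraph (rectDomain L 1) 1) x (st c₃ 0) (st c₄ 1) := by
  rcases lt_trichotomy c₃ c₄ with h₃₄ | rfl | h₄₃
  · -- (A) the top site is to the right of all three bottom sites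
    exact stub_ladder_bbbt_adjacent L h₁₂ h₂₃ h₃₄ h₄ hx0 hx
  · -- (B) the top site sits above the third bottom site
    exact stub_ladder_bbbt_rung_adjacent L h₁₂ h₂₃ h₃ hx0 hx
  rcases lt_trichotomy c₂ c₄ with h₂₄ | rfl | h₄₂
  · -- (C) the top site is strictly between the second and the third bottom columns
    exact stub_ladder_bbbt_inner_adjacent L h₁₂ h₂₄ h₄₃ h₃ hx0 hx
  · -- (D) the top site sits above the middle bottom site
    exact ccwBbbt_N1_over L h₁₂ h₂₃ h₃ hx0 hx
  · -- (E)-(G) the top site is strictly left of the second bottom column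
    exact ccwBbbt_N1_left L h₁₂ h₂₃ h₃ h₄₂ hx0 hx

/-- **Dispatcher `ladder_ccw_bbbt` (wave 7).** Three bottom sites `c₁ < c₂ < c₃ ≤ L` and ANY top site
`(c₄,1)`, `c₄ ≤ L` (the counter-clockwise quadruple `(c₁,0),(c₂,0),(c₃,0),(c₄,1)`), `0 ≤ x ≤ 1/2`: both
non-crossing pairings beat the crossing one.  The adjacent pairing is `ccwBbbt_N1` (sub-cases by `c₄` versus
`c₂, c₃`, each settled by a landed lemma: `stub_ladder_bbbt_adjacent`, `_rung_adjacent`, `_inner_adjacent`,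
the mirrored `_over_nested`, `stub_ladder_minorCB`); the nested pairing is its mirror image under `c ↦ L - c`
(`stub_rect_reflect`), i.e. `ccwBbbt_N1` for the bottom sites `L-c₃ < L-c₂ < L-c₁` and the top site
`(L-c₄,1)`, reflected back. [folklore] -/
theorem ladder_ccw_bbbt (L : ℕ) {c₁ c₂ c₃ c₄ : ℕ} (h₁₂ : c₁ < c₂) (h₂₃ : c₂ < c₃) (h₃ : c₃ ≤ L) (h₄ : c₄ ≤ L)
    {x : ℝ} (hx0 : 0 ≤ x) (hx : x ≤ 1 / 2) :
    (pathKernel (discreteDomainGraph (rectDomain L 1) 1) x (st c₁ 0) (st c₃ 0) *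
        pathKernel (discreteDomainGraph (rectDomain L 1) 1) x (st c₂ 0) (st c₄ 1) ≤
      pathKernel (discreteDomainGraph (rectDomain L 1) 1) x (st c₁ 0) (st c₂ 0) *
        pathKernel (discreteDomainGraph (rectDomain L 1) 1) x (st c₃ 0) (st c₄ 1)) ∧
    (pathKernel (discreteDomainGraph (rectDomain L 1) 1) x (st c₁ 0) (st c₃ 0) *
        pathKernel (discreteDomainGraph (rectDomain L 1) 1) x (st c₂ 0) (st c₄ 1) ≤
      pathKernel (discreteDomainGraph (rectDomain L 1) 1) x (st c₁ 0) (st c₄ 1) *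
        pathKernel (discreteDomainGraph (rectDomain L 1) 1) x (st c₂ 0) (st c₃ 0)) := by
  refine ⟨ccwBbbt_N1 L h₁₂ h₂₃ h₃ h₄ hx0 hx, ?_⟩
  have h₂ : c₂ ≤ L := h₂₃.le.trans h₃
  have h₁ : c₁ ≤ L := h₁₂.le.trans h₂
  -- `N1` for the mirrored configuration: bottoms `L-c₃ < L-c₂ < L-c₁`, top `(L-c₄, 1)`
  have key := ccwBbbt_N1 L (c₁ := L - c₃) (c₂ := L - c₂) (c₃ := L - c₁) (c₄ := L - c₄)
    (by omega) (by omega) (Nat.sub_le L c₁) (Nat.sub_le L c₄) hx0 hx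
  rw [ccwBbbt_reflect L x h₃ h₁ 0 0, ccwBbbt_reflect L x h₂ h₄ 0 1, ccwBbbt_reflect L x h₃ h₂ 0 0,
    ccwBbbt_reflect L x h₁ h₄ 0 1, pathKernel_comm _ x (st (c₃ : ℤ) 0) (st (c₁ : ℤ) 0),
    pathKernel_comm _ x (st (c₃ : ℤ) 0) (st (c₂ : ℤ) 0)] at key
  exact key.trans_eq (mul_comm _ _)

end Summit.CriticalPhenomena.SAWScalingLimit.Theorems.BoundaryTP2
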